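import Summits.BirchSwinnertonDyer.BirchSwinnertonDyer.Theorems.SemiOrdinaryEisensteinDescentWildSplitEisensteinValueAtOneVNonsplitUnramifiedKummer
import HarnessLib

/-!
# The four-kind congruence-visibility certificate with kind (iv) «one curve good, the other non-split multiplicative, v ∤ p»
# in BOTH orientations and NO named-fact binder

Route `SemiOrdinaryEisensteinDescent` (SOED), crux of record E_𝟙^V `WildSplitEisensteinValueAtOneV` (stmt-BirchSwinnertonDyer-26610),
width seat bsd-wall-soed-p1-w3 g22 (`--supports 26610 --as helper`). THEOREMS ONLY. Third file of the seat's kind-(iv) series: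
`…NonsplitKummerUnramified.lean` (M: Kummer image unramified at a non-split `v ∤ p`; C1; `exists_sha_ne_zero_of_congr_of_places₄_factFree`
with kind (iv′) in the orientation «E good, E′ non-split» only) and `…NonsplitUnramifiedKummer.lean` (M′: the converse; Fisher 2016
Thm. 4.4 at `v ∤ p` in both orientations, `mem_selmerLocalKer_iff_h1Equiv_mem_of_nonsplit_good`). Here the certificate shape of
`WeierstrassCurve.exists_sha_ne_zero_of_congr_of_places₄` (`Fisher2016/CongruentKummerConditions.lean`) with its kind (iv) taken at
`v ∤ p` in EITHER orientation and the three named-fact binders `hU`, `hU2`, `hF` of the original ALL replaced by tree theorems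
(`TateCurve.Silverman1994_thmV53_tateUniformisation_holds`, `…corV54_tateUniformisation_holds`, and M/M′): for the rank-`0`
companion records of the cells `b2b-bsdres` / `Rank1Residual` this is the binder-free form of the certificate they display at places
`v ∤ p` (the sub-case `v ∣ p`, `e(v|p) < p − 1` of kind (iv) remains print). BSD is not proved by any of this.

## References
* [Fisher2016Visualizing7] T. Fisher, LMS J. Comput. Math. 19 (2016) Suppl. A, Thm. 4.4 (p. 106).
* [CremonaMazur2000] J. E. Cremona, B. Mazur, Experiment. Math. 9 (2000), §3; [AgasheStein2002] Thm. 3.1, §3.5.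
* [SilvermanATAEC1994] J. H. Silverman, *ATAEC*, Ch. V Thm. 3.1, Lemma 5.2, Thm. 5.3, Cor. 5.4.
-/

set_option autoImplicit false
-- the conventional namespace `Summit.BirchSwinnertonDyer.BirchSwinnertonDyer.Theorems.…` repeats the summit name
set_option linter.dupNamespace false

noncomputable section

open scoped Classical

open NumberField IsDedekindDomain Field WeierstrassCurve
open Literature.NumberTheory.EllipticCurves Literature.NumberTheory.GaloisRepresentations

namespace Summit.BirchSwinnertonDyer.BirchSwinnertonDyer.Theorems.NonsplitKummerUnramified

variable {K : Type} [Field K] [NumberField K] (W : WeierstrassCurve K) [W.IsElliptic]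
  {p : ℕ} [hp : Fact p.Prime]

/-- **Visible `Ш(E/K)[p] ≠ 0` from a `p`-congruent curve — PAY at the places of `T`, AGREE elsewhere — with kind (iv) in BOTH
orientations at `v ∤ p` and NO named-fact binder.** As `WeierstrassCurve.exists_sha_ne_zero_of_congr_of_places₄` (odd `p`,
`θ : E′[p] ⥲ E[p]`, `T ⊆ S`, `E, E′` good with `v ∤ p` off `S`, `E(K)` finite of order prime to `p`, the places of `T` paid for by
`∏_{v ∈ T} #E′(K_v)[p] · #(𝓞_v/p) < p^{rank E′(K)}`), every place of `S \ T` being of one of the free kinds (i) `v ∤ p`, `E′(K_v)[p] = 0`;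
(ii) both split multiplicative, `#E(K_v)[p] ≤ p`; (iii) both multiplicative of the same `γ`-class, `μ_p(K_v) = 1`; **(iv) `v ∤ p` and
(`E` non-split multiplicative, `E′` good) or (`E` good, `E′` non-split multiplicative)**. Then `Ш(E/K)[p] ≠ 0`.
[cite: Fisher2016Visualizing7, Thm. 4.4 (p. 106)] [cite: CremonaMazur2000, §3 and Table 1] [cite: AgasheStein2002, Thm. 3.1 and §3.5]
[cite: SilvermanATAEC1994, Ch. V Thm. 3.1, Lemma 5.2, Thm. 5.3, Cor. 5.4] -/
theorem exists_sha_ne_zero_of_congr_of_places₄_factFree₂ (hp2 : p ≠ 2)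
    (W' : WeierstrassCurve K) [W'.IsElliptic]
    (θ : geomTorsion W' (p : ℤ) ≃+ geomTorsion W (p : ℤ))
    (hθ : ∀ (σ : absoluteGaloisGroup K) (P : geomTorsion W' (p : ℤ)), θ (σ • P) = σ • θ P)
    (S T : Finset (HeightOneSpectrum (𝓞 K))) (hTS : T ⊆ S)
    (hS : ∀ w : HeightOneSpectrum (𝓞 K), w ∉ S →
      W.HasGoodReductionAt w ∧ W'.HasGoodReductionAt w ∧ (p : 𝓞 K) ∉ w.asIdeal)
    (hfin : Finite W.toAffine.Point) (hcop : (Nat.card W.toAffine.Point).Coprime p)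
    (hT : (∏ w ∈ T, Nat.card (nsmulAddMonoidHom p :
        (W'.baseChange (w.adicCompletion K)).toAffine.Point →+ _).ker *
        Nat.card (w.adicCompletionIntegers K ⧸
          Ideal.span {(p : w.adicCompletionIntegers K)})) < p ^ W'.mordellWeilRank)
    (hplaces : ∀ w ∈ S, w ∉ T →
      ((p : 𝓞 K) ∉ w.asIdeal ∧ Nat.card (nsmulAddMonoidHom p :
          (W'.baseChange (w.adicCompletion K)).toAffine.Point →+ _).ker = 1) ∨
      (W.HasSplitMultiplicativeReductionAt w ∧ W'.HasSplitMultiplicativeReductionAt w ∧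
        Nat.card (nsmulAddMonoidHom p :
          (W.baseChange (w.adicCompletion K)).toAffine.Point →+ _).ker ≤ p) ∨
      (W.HasMultiplicativeReductionAt w ∧ W'.HasMultiplicativeReductionAt w ∧
        (∃ r : w.adicCompletion K, algebraMap K (w.adicCompletion K) (-(W.c₄ / W.c₆)) =
          r ^ 2 * algebraMap K (w.adicCompletion K) (-(W'.c₄ / W'.c₆))) ∧
        (∀ ζ : w.adicCompletion K, ζ ^ p = 1 → ζ = 1)) ∨
      ((p : 𝓞 K) ∉ w.asIdeal ∧
        ((W.HasMultiplicativeReductionAt w ∧ ¬ W.HasSplitMultiplicativeReductionAt w ∧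
            W'.HasGoodReductionAt w) ∨
          (W.HasGoodReductionAt w ∧ W'.HasMultiplicativeReductionAt w ∧
            ¬ W'.HasSplitMultiplicativeReductionAt w)))) :
    ∃ c : W.sha, c ≠ 0 ∧ p • c = 0 := by
  have hpp : p.Prime := hp.out
  haveI := hfin
  refine exists_sha_ne_zero_of_congr_of_le_off W W' hp2 θ hθ S T hTS hS (fun w hw hwT c hc ↦ ?_) ?_
  · rcases hplaces w hw hwT with ⟨hwp, hloc⟩ | ⟨hWw, hW'w, hcardw⟩ | ⟨hWw, hW'w, hγw, hμw⟩ | ⟨hwp, hkind⟩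
    · exact (relIndex_map_selmerLocalKer_eq_one_iff W W' θ hθ).mp
        (relIndex_map_selmerLocalKer_eq_one_of_card_torsion_eq_one W W' θ hθ hwp hloc) c hc
    · exact W.h1Equiv_mem_selmerLocalKer_of_hasSplitMultiplicativeReductionAt w
        TateCurve.Silverman1994_thmV53_tateUniformisation_holds W' θ hθ hWw hW'w hcardw hc
    · exact W.h1Equiv_mem_selmerLocalKer_of_hasMultiplicativeReductionAt w
        TateCurve.Silverman1994_thmV53_corV54_tateUniformisation_holds hp2 W' θ hθ hWw hW'w hγw hμw hc
    · exact (mem_selmerLocalKer_iff_h1Equiv_mem_of_nonsplit_good W w hp2 W' θ hθ hwp hkind c).mp hc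
  · rw [index_range_zsmul_eq_one_of_coprime hcop, one_mul,
      Finset.prod_congr rfl fun w _ ↦
        (W'.natCard_kummerLocalConditionAt_adicCompletion w hpp.ne_zero)]
    exact lt_of_lt_of_le hT (pow_mordellWeilRank_le_index_range_zsmul W' hpp.ne_zero)

/-- **Over `ℚ` the ramification clause of the original certificate is void AND kind (iv) needs no fact at `ℓ ≠ p`**: the hypothesis
list of `WeierstrassCurve.exists_sha_ne_zero_of_congr_of_places₄_rat` VERBATIM except that kind (iv) carries `ℓ ≠ p`
(`(p : 𝓞 ℚ) ∉ w.asIdeal`), and the three binders `hU hU2 hF` are gone. [cite: Fisher2016Visualizing7, Thm. 4.4 (p. 106)]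
[cite: CremonaMazur2000, §3 and Table 1] [cite: AgasheStein2002, Thm. 3.1 and §3.5] -/
theorem exists_sha_ne_zero_of_congr_of_places₄_factFree₂_rat (hp2 : p ≠ 2)
    (V V' : WeierstrassCurve ℚ) [V.IsElliptic] [V'.IsElliptic]
    (θ : geomTorsion V' (p : ℤ) ≃+ geomTorsion V (p : ℤ))
    (hθ : ∀ (σ : absoluteGaloisGroup ℚ) (P : geomTorsion V' (p : ℤ)), θ (σ • P) = σ • θ P)
    (S T : Finset (HeightOneSpectrum (𝓞 ℚ))) (hTS : T ⊆ S)
    (hS : ∀ w : HeightOneSpectrum (𝓞 ℚ), w ∉ S →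
      V.HasGoodReductionAt w ∧ V'.HasGoodReductionAt w ∧ (p : 𝓞 ℚ) ∉ w.asIdeal)
    (hfin : Finite V.toAffine.Point) (hcop : (Nat.card V.toAffine.Point).Coprime p)
    (hT : (∏ w ∈ T, Nat.card (nsmulAddMonoidHom p :
        (V'.baseChange (w.adicCompletion ℚ)).toAffine.Point →+ _).ker *
        Nat.card (w.adicCompletionIntegers ℚ ⧸
          Ideal.span {(p : w.adicCompletionIntegers ℚ)})) < p ^ V'.mordellWeilRank)
    (hplaces : ∀ w ∈ S, w ∉ T →
      ((p : 𝓞 ℚ) ∉ w.asIdeal ∧ Nat.card (nsmulAddMonoidHom p :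
          (V'.baseChange (w.adicCompletion ℚ)).toAffine.Point →+ _).ker = 1) ∨
      (V.HasSplitMultiplicativeReductionAt w ∧ V'.HasSplitMultiplicativeReductionAt w ∧
        Nat.card (nsmulAddMonoidHom p :
          (V.baseChange (w.adicCompletion ℚ)).toAffine.Point →+ _).ker ≤ p) ∨
      (V.HasMultiplicativeReductionAt w ∧ V'.HasMultiplicativeReductionAt w ∧
        (∃ r : w.adicCompletion ℚ, algebraMap ℚ (w.adicCompletion ℚ) (-(V.c₄ / V.c₆)) =
          r ^ 2 * algebraMap ℚ (w.adicCompletion ℚ) (-(V'.c₄ / V'.c₆))) ∧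
        (∀ ζ : w.adicCompletion ℚ, ζ ^ p = 1 → ζ = 1)) ∨
      ((p : 𝓞 ℚ) ∉ w.asIdeal ∧
        ((V.HasMultiplicativeReductionAt w ∧ ¬ V.HasSplitMultiplicativeReductionAt w ∧
            V'.HasGoodReductionAt w) ∨
          (V.HasGoodReductionAt w ∧ V'.HasMultiplicativeReductionAt w ∧
            ¬ V'.HasSplitMultiplicativeReductionAt w)))) :
    ∃ c : V.sha, c ≠ 0 ∧ p • c = 0 :=
  exists_sha_ne_zero_of_congr_of_places₄_factFree₂ V hp2 V' θ hθ S T hTS hS hfin hcop hT hplaces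

end Summit.BirchSwinnertonDyer.BirchSwinnertonDyer.Theorems.NonsplitKummerUnramified

end
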